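import Summits.BirchSwinnertonDyer.BirchSwinnertonDyer.Theorems.ByReductionTypeAtTwoTorsionEulerCharFactOfPrint
import Literature.NumberTheory.EllipticCurves.Greenberg1999.RankZeroEulerCharacteristicAnyPrime
import HarnessLib

set_option linter.dupNamespace false -- `…BirchSwinnertonDyer.BirchSwinnertonDyer…` is the cell's nested layout (D-0017)
set_option autoImplicit false

/-!
# The parity-free named fact `Greenberg1999.thm41_charValue_rankZero_anyPrime` (Thm 4.1 over `ℚ` at EVERY prime, `2` included)
# DERIVED from KERNEL + the ONE cite-tagged print fact `Greenberg1999.lemma46_gammaInvariants_auxPlace_rat` (part 17 of the series)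

Cell `bsd-2adic` (run/shared/lean/pub/bsd-2adic/), seat `bsd-2adic-tower-1` GEN 33; `--supports stmt-BirchSwinnertonDyer-19271` (helper).
THEOREMS ONLY (no definition, no named fact, no `sorry`, no restatement: both facts are used BY NAME); closes no item; nothing booked;
no display re-keyed (D-0152); BSD is not proved by any of this.

The tree carries Greenberg's Theorem 4.1 over `ℚ` in rank `0` as TWO named facts: `greenberg_charValue_rankZero` (binder `p ≠ 2`,
> 600 importers) and its parity-free form `Greenberg1999.thm41_charValue_rankZero_anyPrime` (file
`Greenberg1999/RankZeroEulerCharacteristicAnyPrime.lean`; the only extra content is the clause at `p = 2`, which carries the audit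
flag `Gre99-Thm41-at-2-archimedean`). Part 14 (`…TorsionEulerCharFactOfPrint`) derived the first from the Lemma 4.6 fact
(`greenberg_charValue_rankZero_of_print`) and proved the `ℚ_p`-currency at EVERY good ordinary prime (`charValue_rankZero_of_print`,
`2` included, rational `p`-torsion allowed). THIS FILE records the one-line consequence:

* **`thm41_charValue_rankZero_anyPrime_of_print : lemma46_gammaInvariants_auxPlace_rat → thm41_charValue_rankZero_anyPrime`**
  (and back to the odd fact by the tree's `greenberg_charValue_rankZero_of_anyPrime` = part 14's `greenberg_charValue_rankZero_of_print`) —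
  the parity-free fact (hence its `p = 2` clause, the O1 reading of `X5.O1.TwoAdicEulerCharRankZero W 0`) follows from KERNEL
  (parts 1–15: Lemmas 4.2/4.3, Mazur control, Lemma 3.3/3.4 at `n = 0`, Lemma 4.7 with torsion, Cassels' count at `v₀`) plus the
  Lemma 4.6 special case ALONE — a print input audited PRINT-DERIVED and flag-free at `2` (audit-2 sheet «hG46aux @ 2»), in place of
  the flagged reading of Thm. 4.1 at `2`.

HONEST FRAMING: conditional on the cite-tagged `def : Prop` `lemma46_gammaInvariants_auxPlace_rat` (nothing asserted, no `_holds`) and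
on nothing else unprinted. Closes no item; no summit statement is proved; the Birch–Swinnerton-Dyer conjecture is NOT proved by this.

References: [GreenbergLNM1716] Thm. 4.1 (p. 102), §4 Lemma 4.6 (p. 105), Lemma 4.7 (pp. 107–108).
-/

noncomputable section

open scoped Classical NumberField

open NumberField IsDedekindDomain Field

namespace Summit.BirchSwinnertonDyer.BirchSwinnertonDyer.Theorems.TorsionEulerChar

open Literature.NumberTheory.EllipticCurves Literature.NumberTheory.GaloisRepresentations
  WeierstrassCurve ZpExtension Literature.NumberTheory.EllipticCurves.IwasawaAlgebra
  Literature.NumberTheory.EllipticCurves.IwasawaDual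
  Literature.NumberTheory.EllipticCurves.Rank1Residual
  Literature.NumberTheory.EllipticCurves.Greenberg1999

/-- **Greenberg's Thm. 4.1 over `ℚ` in rank `0` at EVERY prime (the parity-free named fact `thm41_charValue_rankZero_anyPrime`,
`2` included, any rational `p`-torsion) follows from the Lemma 4.6 special case `lemma46_gammaInvariants_auxPlace_rat`** — by part
14's `charValue_rankZero_of_print` (KERNEL: parts 1–15 of this series) read in the fact's binders (`GoodOrd W p` =
`W.HasGoodReductionAtPrime p ∧ ¬ p ∣ a_p`; the cyclotomic-variable binder is not used).
[cite: GreenbergLNM1716, Thm. 4.1 (p. 102), §4 Lemmas 4.6–4.7 (pp. 105–108)] -/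
theorem thm41_charValue_rankZero_anyPrime_of_print (h46 : lemma46_gammaInvariants_auxPlace_rat) :
    thm41_charValue_rankZero_anyPrime := by
  intro W _ _ p _ hgood hord κ γ hκ hγ _ D _ _ fE hfE hSel
  haveI := hSel
  exact charValue_rankZero_of_print h46 p W ⟨hgood, hord⟩ κ hκ hγ D fE hfE

end Summit.BirchSwinnertonDyer.BirchSwinnertonDyer.Theorems.TorsionEulerChar

end
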